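import Summits.QuantumFields.BalabanUV.T4Continuum.Spine.NE3.AxialGaugeDivergence
import Summits.QuantumFields.BalabanUV.T4Continuum.Support.NE7CovariantHodgeBond
import HarnessLib

/-!
# NE7CovariantInteriorGradientSharp — THE COVARIANT INTERIOR GRADIENT ESTIMATE WITH THE SHARP CURVATURE BOOKKEEPING: in the axial gauge on the cube the bond
# defects enter through the DIVERGENCE of `W^{axial} − 1` (`δ = 2d²(R+1)x₁ + 8d³(R+1)²x²`, row NE3's `AxialGaugeDivergence`) and through `a·G`, `a²·U` (`a = 2d(R+1)x`),
# NOT through `a·U`: `‖∇_W f(x₀)‖ ≤ 2(dU∕R + R(B + 2δU + 4da(G + 2aU) + 4da²U)) + 2aU` — pub-balaban-gaps ne3's R39 perturbation of R37 with the sup `U` and the a priori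
# gradient `G` kept FREE (their `supRegularity_of_localGauge` fixes `U = C_U·G`); file 47b

Cell `pub-balaban`, rung (B)+1 sub-cell t4, lineage `b2b-balaban-t4-ne7-p1` (CRUX PROVER NE7 #1 = OWNER of row NE7), generation 79; memo
`t4/b2b-balaban-t4-ne7-p1-g79/GRADIENT-LETTER.md` §4.  File F116b (over `Spine/NE3/SupRegularityLocalGauge` (`norm_flatLaplacian_le`, `norm_fdiff_le_gaugeDir_add`),
`Spine/NE3/AxialGaugeDivergence.norm_axialDivergence_le`, `Spine/NE3/LandauCorrectionSupB8LocalGauge.norm_axial_sub_one_le_cube`, R37 `NE3DiscreteGradientEstimate.norm_sub_le_of_laplacian`,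
`NE3CpushGaugeCovariance.gaugeDir_gaugeAct`, `NE3.SlicePoincareSlicB8Gauge.covLapSite_gaugeAct`, F117 `NE7CovariantHodgeBond.cD_add_cDstar_eq`).
WHY.  F116 `NE7CovariantInteriorGradient` priced the axial-gauge bond defects crudely, `(Ad_{V₀(b)} − 1)f ≤ 2·(dR·a)·U`: the resulting term `8d(dR+1)R·x·U` is, at `R = M`,
`O(M²x·U) = O(b·U)` — level-uniform but WITHOUT the power of `M` the (APE) bootstrap needs from the gradient member (memo §4: with the flat slice solver `K_G ≍ M`, every
density multiplied by `K_G` must carry `δ·small∕M³`).  The census-R39 bookkeeping of pub-balaban-gaps ne3 is sharp: the two transport defects at a site pair into the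
COMMUTATOR with the lattice divergence of `E = W^{g} − 1` (`2δU`) plus `4da·G′ + 4da²U` (`G′ = G + 2aU` the flat differences), and in the axial gauge rooted at the cube's
corner `δ ≤ 2d²(R+1)x₁ + 8d³(R+1)²x²` is controlled by the class's covariant PLAQUETTE-GRADIENT radius `x₁` ((1.8)∕[B11] (10) TYPE, `x₁ ≍ c∕M³`) — so at `R = M` every
zeroth-order term is `O((M²x₁ + M³x² + Mx)·U) = O(U∕M)·small` and the first-order term `8RdaG = O(M²x)·G` is absorbed.
WHAT ([folklore]; 0 def, 0 sorry).  §1 the currency bridges `norm_gaugeDir_eq_norm_cD`, `norm_covLapSite_eq`.  §2 **`norm_cD_le_of_covLap_sharp`**: unitary `W`, `SmallField W x`,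
covariant plaquette gradients `≤ x₁`, `‖f‖ ≤ U`, `‖∇_W f‖ ≤ G`, `‖Σ_i(∇_i + ∇_i^†)f‖ ≤ B` everywhere, `R ≥ 1`, `a = 2d(R+1)x`:
`‖∇_{W,τ} f(x₀)‖ ≤ 2(dU∕R + R(B + 2δU + 4da(G + 2aU) + 4da²U)) + 2aU`.
HONEST FRAMING (page 1): lattice analysis of OUR objects at ONE configuration over landed row-NE3∕gaps-ne3 lemmas BY NAME; nothing of Bałaban's asserted; NOT ONE-STEP, NOT NE7;
spine 0∕9; finite T⁴ rung (B)+1 — NOT infinite volume, NOT mass gap, NOT `BetaPertH`, NOT Clay.  Continuum YM on T⁴ ⇐ BetaPertH ∧ nine spine estimates (0/9 proved); BetaPertH ⇐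
(D1) ∧ (D4) ∧ CAP+tail; G-an2-4 gates asym, D1 and NE2/3/4.
-/

set_option autoImplicit false

open scoped BigOperators Matrix Matrix.Norms.L2Operator
open NormedSpace Finset

namespace Summit.QuantumFields.BalabanUV.T4Continuum.NE7CovariantInteriorGradientSharp

open Literature.MathematicalPhysics.QuantumFieldTheory.Balaban1983to89
open B7Prop1Explicit B7Prop2Explicit
open T4AveragingDeficitWall (Ad IsUnitaryCfg SmallField)
open T4AveragingDeficitNonAbelian (Ad_mul Ad_sub)
open AveragingDeficitTransport (norm_Ad_of_unitary mem_U1_of_unitary)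
open AveragingDeficitNearIdentity (Ad_one Ad_neg)
open AveragingDeficitKDatum (isUnitaryCfg_gaugeAct)
open BlockAveragePushDirGauge (gaugeDir)
open NE3CovariantCalculus (cD cDstar)
open NE3CpushGaugeCovariance (gaugeDir_gaugeAct)
open NE3.PairLandauB8 (covLapSite)
open NE3.SlicePoincareSlicB8Gauge (covLapSite_gaugeAct)
open NE3.SupRegularityLocalGauge (norm_flatLaplacian_le norm_fdiff_le_gaugeDir_add)
open NE3.LandauCorrectionSupB8LocalGauge (norm_axial_sub_one_le_cube)
open NE3.AxialGaugeDivergence (norm_axialDivergence_le)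
open NE3DiscreteGradientEstimate (norm_sub_le_of_laplacian)
open NE7CovariantHodgeBond (cD_add_cDstar_eq)

noncomputable section

variable {d : ℕ} {n : Type*} [Fintype n] [DecidableEq n]

/-! ## §1 Currency bridges: `gaugeDir`∕`covLapSite` (row NE3's 0-form vocabulary) against `cD`∕`cDstar` -/

/-- `∇_τ f(y) = −Ad_{W(y,τ)}(gaugeDir W f y τ)`. [folklore] -/
theorem cD_eq_neg_Ad_gaugeDir (W : Site d → Fin d → (Matrix n n ℂ)ˣ) (f : Site d → Matrix n n ℂ) (y : Site d) (τ : Fin d) :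
    cD W τ f y = -Ad (W y τ) (gaugeDir W f y τ) := by
  simp only [cD, gaugeDir, Ad_sub, ← Ad_mul, mul_inv_cancel, Ad_one]
  abel

/-- `‖gaugeDir W f y τ‖ = ‖∇_τ f(y)‖` (unitary `W`). [folklore] -/
theorem norm_gaugeDir_eq_norm_cD [Nonempty n] {W : Site d → Fin d → (Matrix n n ℂ)ˣ} (hW : IsUnitaryCfg W) (f : Site d → Matrix n n ℂ) (y : Site d) (τ : Fin d) :
    ‖gaugeDir W f y τ‖ = ‖cD W τ f y‖ := by
  rw [cD_eq_neg_Ad_gaugeDir, norm_neg, norm_Ad_of_unitary (hW y τ)]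

/-- `covLapSite W f y = −Σ_i (∇_i + ∇_i^†) f (y)`, hence equal norms. [folklore] -/
theorem norm_covLapSite_eq (W : Site d → Fin d → (Matrix n n ℂ)ˣ) (f : Site d → Matrix n n ℂ) (y : Site d) :
    ‖covLapSite W f y‖ = ‖∑ i, (cD W i f y + cDstar W i f y)‖ := by
  have h : ∑ i, (cD W i f y + cDstar W i f y) = -covLapSite W f y := by
    unfold covLapSite
    rw [← Finset.sum_neg_distrib]
    exact Finset.sum_congr rfl fun i _ => cD_add_cDstar_eq W i f y
  rw [h, norm_neg]

/-! ## §2 The sharp covariant interior gradient estimate -/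

/-- **THE COVARIANT INTERIOR GRADIENT ESTIMATE, SHARP FORM.**  `W` unitary with `SmallField W x` and covariant plaquette gradients `≤ x₁`; `f : ℤᵈ → 𝕄` site-framed with
`‖f‖ ≤ U`, a priori `‖∇_W f‖ ≤ G` and `‖Σ_i(∇_i + ∇_i^†)f‖ ≤ B` everywhere; every `R ≥ 1` (`a := 2d(R+1)x`).  Then at every site and direction
`‖∇_{W,τ} f(x₀)‖ ≤ 2·(dU∕R + R·(B + 2δU + 4da(G + 2aU) + 4da²U)) + 2aU`, `δ := 2d²(R+1)x₁ + 8d³(R+1)²x²`. [folklore] -/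
theorem norm_cD_le_of_covLap_sharp [Nonempty n] {W : Site d → Fin d → (Matrix n n ℂ)ˣ} (hW : IsUnitaryCfg W) {x x₁ : ℝ} (hx : 0 ≤ x) (hx₁ : 0 ≤ x₁)
    (hWx : SmallField W x)
    (hgrad : ∀ (p : Site d) (μ κ : Fin d), κ ≠ μ →
      ‖Ad (W p μ) ((hol W (p + e μ) (plaqWord κ μ) : (Matrix n n ℂ)ˣ) : Matrix n n ℂ) - ((hol W p (plaqWord κ μ) : (Matrix n n ℂ)ˣ) : Matrix n n ℂ)‖ ≤ x₁)
    (f : Site d → Matrix n n ℂ) {U G B : ℝ} (hU : ∀ y, ‖f y‖ ≤ U) (hG : ∀ (y : Site d) (τ : Fin d), ‖cD W τ f y‖ ≤ G)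
    (hB : ∀ y, ‖∑ i, (cD W i f y + cDstar W i f y)‖ ≤ B)
    {R : ℕ} (hR : 1 ≤ R) (x₀ : Site d) (τ : Fin d) :
    ‖cD W τ f x₀‖ ≤ 2 * ((d : ℝ) * U / R + R * (B + 2 * (2 * (d : ℝ) ^ 2 * (R + 1) * x₁ + 8 * (d : ℝ) ^ 3 * ((R : ℝ) + 1) ^ 2 * x ^ 2) * U
        + 4 * (d : ℝ) * (2 * (d : ℝ) * (R + 1) * x) * (G + 2 * (2 * (d : ℝ) * (R + 1) * x) * U) + 4 * (d : ℝ) * (2 * (d : ℝ) * (R + 1) * x) ^ 2 * U))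
        + 2 * (2 * (d : ℝ) * (R + 1) * x) * U := by
  -- names
  set a : ℝ := 2 * (d : ℝ) * (R + 1) * x with ha_def
  set δ : ℝ := 2 * (d : ℝ) ^ 2 * (R + 1) * x₁ + 8 * (d : ℝ) ^ 3 * ((R : ℝ) + 1) ^ 2 * x ^ 2 with hδ_def
  have ha0 : 0 ≤ a := by rw [ha_def]; positivity
  have hU0 : 0 ≤ U := (norm_nonneg _).trans (hU x₀)
  -- the axial gauge rooted at the lower corner of the cube of radius `R + 1`
  set g : Site d → (Matrix n n ℂ)ˣ := axialFn W (x₀ - fun _ => (R : ℤ) + 1) with hg_def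
  have hgu : ∀ y, g y ∈ unitaryUnits (Matrix n n ℂ) := fun y => hol_mem_of hW _ _
  set W' : Site d → Fin d → (Matrix n n ℂ)ˣ := gaugeAct g W with hW'_def
  have hW'u : IsUnitaryCfg W' := isUnitaryCfg_gaugeAct hgu hW
  have hga : ∀ (z : Site d) (ν : Fin d), (∀ i, |z i - x₀ i| ≤ (R : ℤ) + 1) → ‖((W' z ν : (Matrix n n ℂ)ˣ) : Matrix n n ℂ) - 1‖ ≤ a :=
    fun z ν hz => norm_axial_sub_one_le_cube hW hx hWx x₀ R z ν hz
  have hgδ : ∀ y : Site d, (∀ i, |y i - x₀ i| ≤ (R : ℤ)) →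
      ‖∑ ν : Fin d, ((((W' y ν : (Matrix n n ℂ)ˣ) : Matrix n n ℂ) - 1) - (((W' (y - e ν) ν : (Matrix n n ℂ)ˣ) : Matrix n n ℂ) - 1))‖ ≤ δ :=
    fun y hy => norm_axialDivergence_le hW hx hx₁ hWx hgrad x₀ R y hy
  -- the gauged field
  set v : Site d → Matrix n n ℂ := fun y => Ad (g y) (f y) with hv_def
  have hvU : ∀ y, ‖v y‖ ≤ U := fun y => by rw [hv_def, norm_Ad_of_unitary (hgu y)]; exact hU y
  have hvD : ∀ (y : Site d) (μ : Fin d), gaugeDir W' v y μ = Ad (g (y + e μ)) (gaugeDir W f y μ) := fun y μ => by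
    have h := gaugeDir_gaugeAct g W f
    exact congrFun (congrFun h y) μ
  have hvG : ∀ (y : Site d) (μ : Fin d), ‖gaugeDir W' v y μ‖ ≤ G := fun y μ => by
    rw [hvD, norm_Ad_of_unitary (hgu _), norm_gaugeDir_eq_norm_cD hW]; exact hG y μ
  have hvB : ∀ y : Site d, ‖covLapSite W' v y‖ ≤ B := fun y => by
    have h := congrFun (covLapSite_gaugeAct g W f) y
    rw [hW'_def, hv_def, h, norm_Ad_of_unitary (hgu y), norm_covLapSite_eq]
    exact hB y
  -- flat forward differences near the root
  have hfd : ∀ (y : Site d) (ν : Fin d), (∀ i, |y i - x₀ i| ≤ (R : ℤ) + 1) → ‖v (y + e ν) - v y‖ ≤ G + 2 * a * U := by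
    intro y ν hy
    have h := (norm_fdiff_le_gaugeDir_add hW'u v y ν).1
    have h2 : 2 * ‖((W' y ν : (Matrix n n ℂ)ˣ) : Matrix n n ℂ) - 1‖ * ‖v y‖ ≤ 2 * a * U :=
      mul_le_mul (mul_le_mul_of_nonneg_left (hga y ν hy) (by norm_num)) (hvU y) (norm_nonneg _) (by positivity)
    linarith [hvG y ν]
  -- the flat Laplacian of `v` on the cube of radius `R`
  have hcube1 : ∀ y : Site d, (∀ i, |y i - x₀ i| ≤ (R : ℤ)) → ∀ i, |y i - x₀ i| ≤ (R : ℤ) + 1 := fun y hy i => (hy i).trans (by linarith)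
  have hcube2 : ∀ (y : Site d) (ν : Fin d), (∀ i, |y i - x₀ i| ≤ (R : ℤ)) → ∀ i, |(y - e ν) i - x₀ i| ≤ (R : ℤ) + 1 := by
    intro y ν hy i
    have h1 := hy i
    rw [Pi.sub_apply, e_apply]
    split_ifs
    · rw [abs_le] at h1 ⊢; constructor <;> linarith [h1.1, h1.2]
    · rw [sub_zero]; exact h1.trans (by linarith)
  have hlap : ∀ y : Site d, (∀ i, |y i - x₀ i| ≤ (R : ℤ)) →
      ‖∑ ν : Fin d, ((v (y + e ν) - v y) - (v y - v (y - e ν)))‖ ≤ B + 2 * δ * U + 4 * (d : ℝ) * a * (G + 2 * a * U) + 4 * (d : ℝ) * a ^ 2 * U := by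
    intro y hy
    have h := norm_flatLaplacian_le hW'u v y (a := a) (δ := δ) (U := U) (G' := G + 2 * a * U) ha0
      (fun ν => ⟨hga y ν (hcube1 y hy), hga (y - e ν) ν (hcube2 y ν hy)⟩) (hgδ y hy) (hvU y)
      (fun ν => ⟨hfd y ν (hcube1 y hy), by
        have h1 := hfd (y - e ν) ν (hcube2 y ν hy)
        rw [sub_add_cancel] at h1
        rwa [norm_sub_rev]⟩)
    linarith [hvB y]
  -- R37 for `v` at the root, then back to the covariant difference
  have hkey := norm_sub_le_of_laplacian x₀ τ hR v (U := U) (fun y _ => hvU y) hlap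
  have h := (norm_fdiff_le_gaugeDir_add hW'u v x₀ τ).2
  have h2 : 2 * ‖((W' x₀ τ : (Matrix n n ℂ)ˣ) : Matrix n n ℂ) - 1‖ * ‖v x₀‖ ≤ 2 * a * U :=
    mul_le_mul (mul_le_mul_of_nonneg_left (hga x₀ τ fun i => by simp; positivity) (by norm_num)) (hvU _) (norm_nonneg _) (by positivity)
  have h3 : ‖cD W τ f x₀‖ = ‖gaugeDir W' v x₀ τ‖ := by rw [hvD, norm_Ad_of_unitary (hgu _), norm_gaugeDir_eq_norm_cD hW]
  rw [h3]
  linarith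

end

end Summit.QuantumFields.BalabanUV.T4Continuum.NE7CovariantInteriorGradientSharp
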